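import Literature.Analysis.FluidPDE.PlanarCornerElement
import HarnessLib

/-!
# The moving rigid corner: translation and slide of the U-standard corner element

Topic `Literature/Analysis/FluidPDE`. Element file of the explicit pullback calculus for the
planar transport equation. `PlanarCornerElement.lean` provides the corner element for arbitrary
graph / material data `(T, Ξ)` in the diagonal frame `(u, v) = (x - y, x + y)`. The rectilinear
designs move a corner only RIGIDLY: a translation of the plane by `(e(t), h(t))` — in frame
coordinates `u ↦ u + p`, `v ↦ v + q` with `p = e - h`, `q = e + h` — while the material slides
along the bent band by `s(t)`. This file fixes that data,

* `mcT a c ρ p q t u = tent(u - p(t)) + q(t)` (the translated tent profile) with its partial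
  derivatives `mcTt`, `mcTx` (`tentSlope = 1 - 2 step`),
* `mcΞ κ p s t u = κ (u - p(t) - s(t))` (rigid material, thickness scale `κ`, `Ξₓ = κ`),
* `mcP` (the antiderivative of `∂ₜT` entering the stream function),

proves the derivative identities feeding `transport_cornerScalar` /
`cornerVelocity_eq_perpGrad_cornerStream` (`transport_movingCorner`,
`movingCornerVelocity_eq_perpGrad`), smoothness, and — the point of the file — the **arm
identities of the moving corner**: off the apex zone the scalar is a straight band around the
moving line (`movingCornerScalar_eq_hBand / _eq_vBand`) and the stream function is the AFFINE
function `((p'-q')/2) x + ((p'+q')/2 + s') y + C_in(t)` on the incoming arm, resp.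
`((p'-q')/2 + s') x + ((p'+q')/2) y + C_out(t)` on the outgoing arm
(`movingCornerStream_eq_affine_in / _out`): translation velocity `(e', h') = ((p'+q')/2, (q'-p')/2)`
plus the slide `s'` along the arm — exactly the stream function of a rigidly moving straight run
(`PlanarRunElement.runStream_of_rigid`) up to a function of `t` alone, which is how consecutive
elements of a chain are matched.

Folklore; no named facts. Infrastructure towards a discharge of `acm_compatible_blocks`
(`QuasiSelfSimilarCompatibleBlocks.lean`).

## References

* G. Alberti, G. Crippa, A. L. Mazzucato, *Exponential self-similar mixing by incompressible
  flows*, J. Amer. Math. Soc. 32 (2019), 445–490, §7 (arXiv:1605.02090).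
-/

noncomputable section

open Function Set Filter
open scoped Topology ContDiff

namespace Literature.Analysis.FluidPDE

namespace PlanarKinematics

open Gluing

/-- The plane `ℝ²` as a Euclidean space. [folklore] -/
local notation "E²" => EuclideanSpace ℝ (Fin 2)

variable {G : Type*} [NormedAddCommGroup G] [NormedSpace ℝ G]

/-! ## The slope of the tent profile -/

/-- **Slope of the tent profile** `1 - 2 step ((u - a)/ρ)`: `+1` before, `-1` after the apex zone.
[folklore] -/
def tentSlope (a ρ : ℝ) (u : ℝ) : ℝ := 1 - 2 * step ((u - a) / ρ)

/-- Unfolding the slope. [folklore] -/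
theorem tentSlope_apply (a ρ u : ℝ) : tentSlope a ρ u = 1 - 2 * step ((u - a) / ρ) := rfl

/-- The tent profile has derivative `tentSlope`. [folklore] -/
theorem hasDerivAt_tentProfile' {a c ρ : ℝ} (hρ : ρ ≠ 0) (u : ℝ) :
    HasDerivAt (tentProfile a c ρ) (tentSlope a ρ u) u :=
  hasDerivAt_tentProfile hρ u

/-- Before the apex zone the slope is `+1`. [folklore] -/
theorem tentSlope_of_le {a ρ u : ℝ} (hρ : 0 < ρ) (hu : u ≤ a + ρ / 3) : tentSlope a ρ u = 1 := by
  rw [tentSlope_apply, step_of_le, mul_zero, sub_zero]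
  rw [div_le_iff₀ hρ]; linarith

/-- After the apex zone the slope is `-1`. [folklore] -/
theorem tentSlope_of_ge {a ρ u : ℝ} (hρ : 0 < ρ) (hu : a + 2 * ρ / 3 ≤ u) : tentSlope a ρ u = -1 := by
  rw [tentSlope_apply, step_of_ge]
  · norm_num
  · rw [le_div_iff₀ hρ]; linarith

/-- The slope is smooth. [folklore] -/
theorem tentSlope_contDiff {a ρ : ℝ} {n : ℕ∞} : ContDiff ℝ n (tentSlope a ρ) :=
  contDiff_const.sub (contDiff_const.mul (step_contDiff.comp ((contDiff_id.sub contDiff_const).div_const _)))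

/-! ## Data of the moving rigid corner -/

section Data

variable (a c ρ κ : ℝ) (p q s p' q' s' : ℝ → ℝ)

/-- Translated tent profile `T(t, u) = tent(u - p(t)) + q(t)`. [folklore] -/
def mcT (t u : ℝ) : ℝ := tentProfile a c ρ (u - p t) + q t

/-- `∂ₜT = -slope(u - p) p' + q'`. [folklore] -/
def mcTt (t u : ℝ) : ℝ := -tentSlope a ρ (u - p t) * p' t + q' t

/-- `∂ᵤT = slope(u - p)`. [folklore] -/
def mcTx (t u : ℝ) : ℝ := tentSlope a ρ (u - p t)

/-- Rigid material map `Ξ(t, u) = κ (u - p(t) - s(t))`. [folklore] -/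
def mcΞ (t u : ℝ) : ℝ := κ * (u - p t - s t)

/-- `Ξₓ = κ`. [folklore] -/
def mcΞx (_ _ : ℝ) : ℝ := κ

/-- `Ξₜ = -κ (p' + s')`. [folklore] -/
def mcΞt (t _ : ℝ) : ℝ := -κ * (p' t + s' t)

/-- The antiderivative `P(t, u) = -p' tent(u - p) + q' u` of `∂ₜT` in `u`. [folklore] -/
def mcP (t u : ℝ) : ℝ := -p' t * tentProfile a c ρ (u - p t) + q' t * u

/-- The Eulerian rate of the rigid material is the uniform `p' + s'`. [folklore] -/
theorem axialRate_mc (hκ : κ ≠ 0) (t u : ℝ) : axialRate (mcΞx κ) (mcΞt κ p' s') t u = p' t + s' t := by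
  simp only [axialRate, mcΞx, mcΞt]
  field_simp

/-- The rate derivative of the rigid material vanishes. [folklore] -/
theorem axialRateDeriv_mc (t u : ℝ) :
    axialRateDeriv (mcΞx κ) (mcΞt κ p' s') (fun _ _ => 0) (fun _ _ => 0) t u = 0 := by
  simp [axialRateDeriv]

end Data

/-! ## Derivative identities -/

section Derivs

variable {a c ρ κ : ℝ} {p q s p' q' s' : ℝ → ℝ} {t u : ℝ}

/-- `∂ₜ T`. [folklore] -/
theorem hasDerivAt_mcT_t (hρ : ρ ≠ 0) (hp : HasDerivAt p (p' t) t) (hq : HasDerivAt q (q' t) t) :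
    HasDerivAt (fun σ => mcT a c ρ p q σ u) (mcTt a ρ p p' q' t u) t := by
  have h1 : HasDerivAt (fun σ => u - p σ) (-p' t) t := by simpa using hp.const_sub u
  have h2 := ((hasDerivAt_tentProfile' (a := a) (c := c) hρ (u - p t)).comp t h1).add hq
  refine (h2.congr_deriv ?_).congr_of_eventuallyEq (Eventually.of_forall fun σ => rfl)
  simp only [mcTt]; ring

/-- `∂ᵤ T`. [folklore] -/
theorem hasDerivAt_mcT_u (hρ : ρ ≠ 0) : HasDerivAt (mcT a c ρ p q t) (mcTx a ρ p t u) u := by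
  have h1 : HasDerivAt (fun w => w - p t) 1 u := (hasDerivAt_id' u).sub_const (p t)
  have h2 := ((hasDerivAt_tentProfile' (a := a) (c := c) hρ (u - p t)).comp u h1).add_const (q t)
  refine (h2.congr_deriv ?_).congr_of_eventuallyEq (Eventually.of_forall fun w => rfl)
  simp only [mcTx]; ring

/-- `∂ₜ Ξ`. [folklore] -/
theorem hasDerivAt_mcΞ_t (hp : HasDerivAt p (p' t) t) (hs : HasDerivAt s (s' t) t) :
    HasDerivAt (fun σ => mcΞ κ p s σ u) (mcΞt κ p' s' t u) t := by
  have h := ((hp.const_sub u).sub hs).const_mul κ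
  refine (h.congr_deriv ?_).congr_of_eventuallyEq (Eventually.of_forall fun σ => rfl)
  simp only [mcΞt]; ring

/-- `∂ᵤ Ξ`. [folklore] -/
theorem hasDerivAt_mcΞ_u : HasDerivAt (mcΞ κ p s t) (mcΞx κ t u) u := by
  have h := (((hasDerivAt_id' u).sub_const (p t)).sub_const (s t)).const_mul κ
  refine (h.congr_deriv ?_).congr_of_eventuallyEq (Eventually.of_forall fun w => rfl)
  simp only [mcΞx]; ring

/-- `∂ᵤ Ξₓ = 0`. [folklore] -/
theorem hasDerivAt_mcΞx_u : HasDerivAt (mcΞx κ t) ((fun (_ : ℝ) (_ : ℝ) => (0 : ℝ)) t u) u :=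
  hasDerivAt_const _ _

/-- `∂ₜ Ξₓ = 0`. [folklore] -/
theorem hasDerivAt_mcΞx_t : HasDerivAt (fun σ => mcΞx κ σ u) ((fun (_ : ℝ) (_ : ℝ) => (0 : ℝ)) t u) t :=
  hasDerivAt_const _ _

/-- `∂ᵤ Ξₜ = 0`. [folklore] -/
theorem hasDerivAt_mcΞt_u : HasDerivAt (mcΞt κ p' s' t) ((fun (_ : ℝ) (_ : ℝ) => (0 : ℝ)) t u) u :=
  hasDerivAt_const _ _

/-- `∂ᵤ P = ∂ₜ T`. [folklore] -/
theorem hasDerivAt_mcP_u (hρ : ρ ≠ 0) : HasDerivAt (mcP a c ρ p p' q' t) (mcTt a ρ p p' q' t u) u := by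
  have h1 : HasDerivAt (fun w => w - p t) 1 u := (hasDerivAt_id' u).sub_const (p t)
  have h2 := (hasDerivAt_tentProfile' (a := a) (c := c) hρ (u - p t)).comp u h1
  have h3 := (h2.const_mul (-p' t)).add ((hasDerivAt_id' u).const_mul (q' t))
  refine (h3.congr_deriv ?_).congr_of_eventuallyEq (Eventually.of_forall fun w => rfl)
  simp only [mcTt]; ring

/-- The rate of the rigid material, as a function of `u`, has derivative `axialRateDeriv = 0`.
[folklore] -/
theorem hasDerivAt_axialRate_mc (hκ : κ ≠ 0) :
    HasDerivAt (axialRate (mcΞx κ) (mcΞt κ p' s') t)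
      (axialRateDeriv (mcΞx κ) (mcΞt κ p' s') (fun _ _ => 0) (fun _ _ => 0) t u) u :=
  hasDerivAt_axialRate hasDerivAt_mcΞt_u hasDerivAt_mcΞx_u hκ

end Derivs

/-! ## The moving corner: transport, stream function, smoothness -/

section Moving

variable {a c ρ κ : ℝ} {p q s p' q' s' : ℝ → ℝ}

/-- **The moving rigid corner is transported** by its corner velocity (data `mcT`, `mcΞ`), at
every point, for a differentiable profile. [folklore] -/
theorem transport_movingCorner {Gp : ℝ → G} {t : ℝ} {z : E²} (hρ : ρ ≠ 0) (hκ : κ ≠ 0)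
    (hG : DifferentiableAt ℝ Gp ((graphPullback (mcT a c ρ p q) (mcΞ κ p s) (mcΞx κ) t (diagFrame z)) 1))
    (hp : HasDerivAt p (p' t) t) (hq : HasDerivAt q (q' t) t) (hs : HasDerivAt s (s' t) t) :
    deriv (fun σ => cornerScalar Gp (mcT a c ρ p q) (mcΞ κ p s) (mcΞx κ) σ z) t +
      fderiv ℝ (cornerScalar Gp (mcT a c ρ p q) (mcΞ κ p s) (mcΞx κ) t) z
        (cornerVelocity (axialRate (mcΞx κ) (mcΞt κ p' s'))
          (axialRateDeriv (mcΞx κ) (mcΞt κ p' s') (fun _ _ => 0) (fun _ _ => 0))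
          (mcT a c ρ p q) (mcTt a ρ p p' q') (mcTx a ρ p) t z) = 0 :=
  transport_cornerScalar hG (hasDerivAt_mcT_t hρ hp hq) (hasDerivAt_mcT_u hρ) (hasDerivAt_mcΞ_t hp hs)
    hasDerivAt_mcΞ_u hasDerivAt_mcΞx_u hasDerivAt_mcΞx_t hκ

/-- **The moving corner velocity is the perpendicular gradient of its stream function**
`cornerStream (rate) mcT mcP`. [folklore] -/
theorem movingCornerVelocity_eq_perpGrad {t : ℝ} {z : E²} (hρ : ρ ≠ 0) (hκ : κ ≠ 0) :
    cornerVelocity (axialRate (mcΞx κ) (mcΞt κ p' s'))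
        (axialRateDeriv (mcΞx κ) (mcΞt κ p' s') (fun _ _ => 0) (fun _ _ => 0))
        (mcT a c ρ p q) (mcTt a ρ p p' q') (mcTx a ρ p) t z =
      perpGrad (cornerStream (axialRate (mcΞx κ) (mcΞt κ p' s')) (mcT a c ρ p q) (mcP a c ρ p p' q') t) z :=
  cornerVelocity_eq_perpGrad_cornerStream (hasDerivAt_axialRate_mc hκ) (hasDerivAt_mcT_u hρ) (hasDerivAt_mcP_u hρ)

/-- Smoothness of the translated tent profile. [folklore] -/
theorem contDiff_uncurry_mcT (hp : ContDiff ℝ ∞ p) (hq : ContDiff ℝ ∞ q) : ContDiff ℝ ∞ (uncurry (mcT a c ρ p q)) :=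
  (tentProfile_contDiff.comp (contDiff_snd.sub (hp.comp contDiff_fst))).add (hq.comp contDiff_fst)

/-- Smoothness of `∂ₜT`. [folklore] -/
theorem contDiff_uncurry_mcTt (hp : ContDiff ℝ ∞ p) (hp' : ContDiff ℝ ∞ p') (hq' : ContDiff ℝ ∞ q') :
    ContDiff ℝ ∞ (uncurry (mcTt a ρ p p' q')) :=
  ((tentSlope_contDiff.comp (contDiff_snd.sub (hp.comp contDiff_fst))).neg.mul (hp'.comp contDiff_fst)).add
    (hq'.comp contDiff_fst)

/-- Smoothness of `∂ᵤT`. [folklore] -/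
theorem contDiff_uncurry_mcTx (hp : ContDiff ℝ ∞ p) : ContDiff ℝ ∞ (uncurry (mcTx a ρ p)) :=
  tentSlope_contDiff.comp (contDiff_snd.sub (hp.comp contDiff_fst))

/-- Smoothness of the rigid material map. [folklore] -/
theorem contDiff_uncurry_mcΞ (hp : ContDiff ℝ ∞ p) (hs : ContDiff ℝ ∞ s) : ContDiff ℝ ∞ (uncurry (mcΞ κ p s)) :=
  contDiff_const.mul ((contDiff_snd.sub (hp.comp contDiff_fst)).sub (hs.comp contDiff_fst))

/-- Smoothness of `Ξₓ`. [folklore] -/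
theorem contDiff_uncurry_mcΞx : ContDiff ℝ ∞ (uncurry (mcΞx κ)) := contDiff_const

/-- Smoothness of `Ξₜ`. [folklore] -/
theorem contDiff_uncurry_mcΞt (hp' : ContDiff ℝ ∞ p') (hs' : ContDiff ℝ ∞ s') :
    ContDiff ℝ ∞ (uncurry (mcΞt κ p' s')) :=
  contDiff_const.mul ((hp'.comp contDiff_fst).add (hs'.comp contDiff_fst))

/-- Smoothness of `P`. [folklore] -/
theorem contDiff_uncurry_mcP (hp : ContDiff ℝ ∞ p) (hp' : ContDiff ℝ ∞ p') (hq' : ContDiff ℝ ∞ q') :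
    ContDiff ℝ ∞ (uncurry (mcP a c ρ p p' q')) :=
  ((hp'.comp contDiff_fst).neg.mul (tentProfile_contDiff.comp (contDiff_snd.sub (hp.comp contDiff_fst)))).add
    ((hq'.comp contDiff_fst).mul contDiff_snd)

/-- **The moving corner scalar is smooth.** [folklore] -/
theorem contDiff_uncurry_movingCornerScalar {Gp : ℝ → G} (hGp : ContDiff ℝ ∞ Gp) (hκ : κ ≠ 0)
    (hp : ContDiff ℝ ∞ p) (hq : ContDiff ℝ ∞ q) (hs : ContDiff ℝ ∞ s) :
    ContDiff ℝ ∞ (uncurry (cornerScalar Gp (mcT a c ρ p q) (mcΞ κ p s) (mcΞx κ))) :=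
  contDiff_uncurry_cornerScalar hGp (contDiff_uncurry_mcT hp hq) (contDiff_uncurry_mcΞ hp hs) contDiff_uncurry_mcΞx
    fun _ _ => hκ

/-- **The moving corner velocity is smooth.** [folklore] -/
theorem contDiff_uncurry_movingCornerVelocity (hκ : κ ≠ 0) (hp : ContDiff ℝ ∞ p) (hq : ContDiff ℝ ∞ q)
    (hp' : ContDiff ℝ ∞ p') (hq' : ContDiff ℝ ∞ q') (hs' : ContDiff ℝ ∞ s') :
    ContDiff ℝ ∞ (uncurry (cornerVelocity (axialRate (mcΞx κ) (mcΞt κ p' s'))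
      (axialRateDeriv (mcΞx κ) (mcΞt κ p' s') (fun _ _ => 0) (fun _ _ => 0))
      (mcT a c ρ p q) (mcTt a ρ p p' q') (mcTx a ρ p))) :=
  contDiff_uncurry_cornerVelocity (contDiff_uncurry_axialRate contDiff_uncurry_mcΞx (contDiff_uncurry_mcΞt hp' hs')
      fun _ _ => hκ)
    (contDiff_uncurry_axialRateDeriv contDiff_uncurry_mcΞx (contDiff_uncurry_mcΞt hp' hs') contDiff_const
      contDiff_const fun _ _ => hκ)
    (contDiff_uncurry_mcT hp hq) (contDiff_uncurry_mcTt hp hp' hq') (contDiff_uncurry_mcTx hp)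

/-- **The moving corner stream function is smooth.** [folklore] -/
theorem contDiff_uncurry_movingCornerStream (hκ : κ ≠ 0) (hp : ContDiff ℝ ∞ p) (hq : ContDiff ℝ ∞ q)
    (hp' : ContDiff ℝ ∞ p') (hq' : ContDiff ℝ ∞ q') (hs' : ContDiff ℝ ∞ s') :
    ContDiff ℝ ∞ (uncurry (cornerStream (axialRate (mcΞx κ) (mcΞt κ p' s')) (mcT a c ρ p q) (mcP a c ρ p p' q'))) :=
  contDiff_uncurry_cornerStream (contDiff_uncurry_axialRate contDiff_uncurry_mcΞx (contDiff_uncurry_mcΞt hp' hs')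
    fun _ _ => hκ) (contDiff_uncurry_mcT hp hq) (contDiff_uncurry_mcP hp hp' hq')

end Moving

/-! ## Arm identities of the moving corner -/

section Arms

variable {a c ρ κ : ℝ} {p q s p' q' s' : ℝ → ℝ} {t : ℝ} {z : E²}

omit [NormedAddCommGroup G] [NormedSpace ℝ G] in
/-- **Incoming arm, scalar**: off the apex zone on the incoming side
(`z₀ - z₁ - p(t) ≤ a + ρ/3`) the moving corner scalar is the straight horizontal band
`Gp ((2 z₁ + p - q + a - c)/κ)` around the moving line `y = (q - p + c - a)/2`. [folklore] -/
theorem movingCornerScalar_eq_hBand {Gp : ℝ → G} (hρ : 0 < ρ) (hz : z 0 - z 1 - p t ≤ a + ρ / 3) :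
    cornerScalar Gp (mcT a c ρ p q) (mcΞ κ p s) (mcΞx κ) t z = Gp ((2 * z 1 + p t - q t + a - c) / κ) := by
  rw [cornerScalar_apply]
  simp only [mcT, mcΞx]
  rw [tentProfile_of_le hρ hz]
  congr 1; ring

omit [NormedAddCommGroup G] [NormedSpace ℝ G] in
/-- **Outgoing arm, scalar**: off the apex zone on the outgoing side
(`a + 2ρ/3 ≤ z₀ - z₁ - p(t)`) the moving corner scalar is the straight vertical band
`Gp ((2 z₀ - p - q - a - ρ - c)/κ)` around the moving line `x = (p + q + a + ρ + c)/2`. [folklore] -/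
theorem movingCornerScalar_eq_vBand {Gp : ℝ → G} (hρ : 0 < ρ) (hz : a + 2 * ρ / 3 ≤ z 0 - z 1 - p t) :
    cornerScalar Gp (mcT a c ρ p q) (mcΞ κ p s) (mcΞx κ) t z = Gp ((2 * z 0 - p t - q t - a - ρ - c) / κ) := by
  rw [cornerScalar_apply]
  simp only [mcT, mcΞx]
  rw [tentProfile_of_ge hρ hz]
  congr 1; ring

/-- **Incoming arm, stream function**: off the apex zone on the incoming side the moving corner
stream function is affine, `((p'-q')/2) z₀ + ((p'+q')/2 + s') z₁ + C_in(t)` with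
`C_in = ((p'+s')(p + a - c - q) + p'(c - p - a))/2` — the stream function of the rigid motion with
velocity `((p'+q')/2 + s', (q'-p')/2)` (translation `(e', h')` plus the slide `s'` eastwards).
[folklore] -/
theorem movingCornerStream_eq_affine_in (hρ : 0 < ρ) (hκ : κ ≠ 0) (hz : z 0 - z 1 - p t ≤ a + ρ / 3) :
    cornerStream (axialRate (mcΞx κ) (mcΞt κ p' s')) (mcT a c ρ p q) (mcP a c ρ p p' q') t z =
      (p' t - q' t) / 2 * z 0 + ((p' t + q' t) / 2 + s' t) * z 1 +
        ((p' t + s' t) * (p t + a - c - q t) + p' t * (c - p t - a)) / 2 := by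
  rw [cornerStream_apply, graphStream_apply, axialRate_mc _ _ _ hκ]
  simp only [mcT, mcP, diagFrame_apply, vec2_apply_zero, vec2_apply_one]
  rw [tentProfile_of_le hρ hz]
  ring

/-- **Outgoing arm, stream function**: off the apex zone on the outgoing side the moving corner
stream function is affine, `((p'-q')/2 + s') z₀ + ((p'+q')/2) z₁ + C_out(t)` with
`C_out = ((p'+s')(-c - ρ - p - a - q) + p'(c + ρ + p + a))/2` — translation `(e', h')` plus the
slide `s'` southwards. [folklore] -/
theorem movingCornerStream_eq_affine_out (hρ : 0 < ρ) (hκ : κ ≠ 0) (hz : a + 2 * ρ / 3 ≤ z 0 - z 1 - p t) :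
    cornerStream (axialRate (mcΞx κ) (mcΞt κ p' s')) (mcT a c ρ p q) (mcP a c ρ p p' q') t z =
      ((p' t - q' t) / 2 + s' t) * z 0 + (p' t + q' t) / 2 * z 1 +
        ((p' t + s' t) * (-c - ρ - p t - a - q t) + p' t * (c + ρ + p t + a)) / 2 := by
  rw [cornerStream_apply, graphStream_apply, axialRate_mc _ _ _ hκ]
  simp only [mcT, mcP, diagFrame_apply, vec2_apply_zero, vec2_apply_one]
  rw [tentProfile_of_ge hρ hz]
  ring

/-- **A corner at rest**: where `p' = q' = s' = 0` at time `t`, the moving corner velocity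
vanishes. [folklore] -/
theorem movingCornerVelocity_eq_zero_of_static (hκ : κ ≠ 0) (hp : p' t = 0) (hq : q' t = 0) (hs : s' t = 0) :
    cornerVelocity (axialRate (mcΞx κ) (mcΞt κ p' s'))
        (axialRateDeriv (mcΞx κ) (mcΞt κ p' s') (fun _ _ => 0) (fun _ _ => 0))
        (mcT a c ρ p q) (mcTt a ρ p p' q') (mcTx a ρ p) t z = 0 := by
  refine cornerVelocity_eq_zero_of_static ?_ (axialRateDeriv_mc _ _ _ _ _) ?_
  · rw [axialRate_mc _ _ _ hκ, hp, hs, add_zero]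
  · simp only [mcTt, hp, hq, mul_zero, add_zero]

end Arms

end PlanarKinematics

end Literature.Analysis.FluidPDE
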